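import Mathlib.Analysis.Calculus.ContDiff.Operations
import Mathlib.Analysis.Calculus.Deriv.MeanValue
import Mathlib.Analysis.SpecialFunctions.SmoothTransition
import Mathlib.Analysis.SpecialFunctions.Sqrt
import Mathlib.Topology.Order.MonotoneContinuity
import HarnessLib

/-!
# One-variable tools for the tubular maps of the Iwase model

Elementary tools used to build the tubular neighbourhood maps `T₀, T₁ : T² × ℝ² → S² × ℝ²` of
the model datum of Iwase's Proposition 3.5 [cite: Iwase1988, Prop. 3.5, p. 296] (reduction
`TorusSurgeryIwaseReduction`):

* `monoHomeomorph`, `contDiff_monoHomeomorph_symm`: a smooth strictly increasing surjection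
  `ℝ → ℝ` with nowhere-vanishing derivative is a homeomorphism with smooth inverse (the easy
  one-variable inverse function theorem, from `Homeomorph.contDiff_symm_deriv`);
  `surjective_of_eq_id_off` (intermediate values);
* `deriv_glue_pos`: gluing two increasing functions with a cut-off is increasing under a *sign*
  condition `(g - f) χ' ≥ 0` (no derivative bounds needed);
* `exists_bound_deriv`, `abs_sub_le_of_deriv`: a `C¹` function that is locally constant outside a
  compact interval has bounded derivative, hence is Lipschitz — used to *define* small parameters
  by an abstract bound;
* `cut a b`: the standard `smoothTransition` cut-off and its elementary properties.
(The radial diffeomorphism `ℝ² ≅` unit ball is Mathlib's `OpenPartialHomeomorph.univUnitBall`.)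

All statements are [folklore].

## References
* Z. Iwase, *Dehn-surgery along a torus T²-knot*, Pacific J. Math. 133 (1988), 289–299,
  Prop. 3.5. [cite: Iwase1988]
-/

open scoped ContDiff Topology
open Set Function Real

noncomputable section

namespace Literature.Topology.FourManifolds

namespace IwaseTori

/-! ### Smooth strictly monotone functions with non-vanishing derivative -/

/-- **A smooth strictly increasing surjection `ℝ → ℝ` is a homeomorphism.** [folklore] -/
def monoHomeomorph (F : ℝ → ℝ) (hmono : StrictMono F) (hsurj : Surjective F) : ℝ ≃ₜ ℝ :=
  (hmono.orderIsoOfSurjective F hsurj).toHomeomorph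

/-- The homeomorphism is the given function. [folklore] -/
@[simp] theorem monoHomeomorph_apply (F : ℝ → ℝ) (hmono : StrictMono F) (hsurj : Surjective F)
    (x : ℝ) : monoHomeomorph F hmono hsurj x = F x := rfl

/-- `F⁻¹ (F x) = x`. [folklore] -/
@[simp] theorem monoHomeomorph_symm_apply_apply (F : ℝ → ℝ) (hmono : StrictMono F)
    (hsurj : Surjective F) (x : ℝ) : (monoHomeomorph F hmono hsurj).symm (F x) = x :=
  (monoHomeomorph F hmono hsurj).symm_apply_apply x

/-- `F (F⁻¹ y) = y`. [folklore] -/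
theorem apply_monoHomeomorph_symm (F : ℝ → ℝ) (hmono : StrictMono F)
    (hsurj : Surjective F) (y : ℝ) : F ((monoHomeomorph F hmono hsurj).symm y) = y :=
  (monoHomeomorph F hmono hsurj).apply_symm_apply y

/-- **The inverse of a smooth strictly increasing surjection with non-vanishing derivative is
smooth** (the easy half of the one-variable inverse function theorem,
`Homeomorph.contDiff_symm_deriv`). [folklore] -/
theorem contDiff_monoHomeomorph_symm {F : ℝ → ℝ} (hF : ContDiff ℝ ∞ F) (hmono : StrictMono F)
    (hsurj : Surjective F) (h0 : ∀ x, deriv F x ≠ 0) :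
    ContDiff ℝ ∞ ((monoHomeomorph F hmono hsurj).symm : ℝ → ℝ) :=
  (monoHomeomorph F hmono hsurj).contDiff_symm_deriv h0
    (fun x => ((hF.differentiable (by simp)) x).hasDerivAt) hF

/-- A function with everywhere positive derivative is strictly increasing (Mathlib), restated.
[folklore] -/
theorem strictMono_of_deriv_pos' {F : ℝ → ℝ} (h : ∀ x, 0 < deriv F x) : StrictMono F :=
  strictMono_of_deriv_pos h

/-- A continuous function `F` with `F x = x` below `a` and above `b` is surjective (intermediate
value theorem). [folklore] -/
theorem surjective_of_eq_id_off {F : ℝ → ℝ} (hF : Continuous F) {a b : ℝ}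
    (hlo : ∀ x ≤ a, F x = x) (hhi : ∀ x, b ≤ x → F x = x) : Surjective F := by
  intro y
  have h1 : F (min y a) = min y a := hlo _ (min_le_right _ _)
  have h2 : F (max y b) = max y b := hhi _ (le_max_right _ _)
  have hle : min y a ≤ max y b := (min_le_left _ _).trans (le_max_left _ _)
  have hmem : y ∈ Icc (F (min y a)) (F (max y b)) := by
    rw [h1, h2]; exact ⟨min_le_left _ _, le_max_left _ _⟩
  obtain ⟨x, _, hx⟩ := intermediate_value_Icc hle hF.continuousOn hmem
  exact ⟨x, hx⟩

/-! ### Gluing increasing functions with a cut-off (a sign condition, no derivative bounds) -/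

/-- **Monotone gluing.** If `f, g` have positive derivative, `χ` is a differentiable cut-off with
values in `[0, 1]`, and `(g - f) χ' ≥ 0` pointwise, then `(1 - χ) f + χ g` has positive
derivative, bounded below by `min f' g'`. [folklore] -/
theorem deriv_glue_pos {f g χ : ℝ → ℝ} (hf : Differentiable ℝ f) (hg : Differentiable ℝ g)
    (hχ : Differentiable ℝ χ) (h0 : ∀ x, 0 ≤ χ x) (h1 : ∀ x, χ x ≤ 1)
    (hsign : ∀ x, 0 ≤ (g x - f x) * deriv χ x) (x : ℝ) :
    min (deriv f x) (deriv g x) ≤ deriv (fun x => (1 - χ x) * f x + χ x * g x) x := by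
  have hd : deriv (fun x => (1 - χ x) * f x + χ x * g x) x =
      (1 - χ x) * deriv f x + χ x * deriv g x + (g x - f x) * deriv χ x := by
    have e1 : HasDerivAt (fun x => (1 - χ x) * f x)
        ((0 - deriv χ x) * f x + (1 - χ x) * deriv f x) x :=
      ((hasDerivAt_const x (1 : ℝ)).sub (hχ x).hasDerivAt).mul (hf x).hasDerivAt
    have e2 : HasDerivAt (fun x => χ x * g x) (deriv χ x * g x + χ x * deriv g x) x :=
      (hχ x).hasDerivAt.mul (hg x).hasDerivAt
    have e3 : HasDerivAt (fun x => (1 - χ x) * f x + χ x * g x)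
        ((0 - deriv χ x) * f x + (1 - χ x) * deriv f x + (deriv χ x * g x + χ x * deriv g x)) x :=
      e1.add e2
    rw [e3.deriv]
    ring
  rw [hd]
  have hmin1 := min_le_left (deriv f x) (deriv g x)
  have hmin2 := min_le_right (deriv f x) (deriv g x)
  nlinarith [h0 x, h1 x, hsign x]

/-! ### Bounds on derivatives of functions that are constant outside a compact interval -/

/-- **A `C¹` function which is locally constant outside `[a, b]` has bounded derivative** (the
derivative is continuous on the compact interval and vanishes outside). Used to *define* small
parameters by an abstract bound instead of estimating `smoothTransition'`. [folklore] -/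
theorem exists_bound_deriv {χ : ℝ → ℝ} (hχ : ContDiff ℝ 1 χ) {a b : ℝ}
    (hlo : ∀ x ≤ a, χ x = χ a) (hhi : ∀ x, b ≤ x → χ x = χ b) :
    ∃ C : ℝ, 0 < C ∧ ∀ x, |deriv χ x| ≤ C := by
  have hcont : Continuous (deriv χ) := hχ.continuous_deriv le_rfl
  obtain ⟨C, hC⟩ := (isCompact_Icc (a := a - 1) (b := b + 1)).exists_bound_of_continuousOn
    hcont.continuousOn
  refine ⟨max C 1, lt_max_of_lt_right one_pos, fun x => ?_⟩
  by_cases hx : x ∈ Icc (a - 1) (b + 1)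
  · exact (hC x hx).trans (le_max_left _ _)
  · -- outside `[a - 1, b + 1]` the function is locally constant, so the derivative vanishes
    have hzero : deriv χ x = 0 := by
      rw [mem_Icc, not_and_or, not_le, not_le] at hx
      rcases hx with hx | hx
      · have hev : χ =ᶠ[𝓝 x] fun _ => χ a := by
          filter_upwards [(isOpen_lt continuous_id continuous_const).mem_nhds
            (show x < a by linarith)] with y hy
          exact hlo y (le_of_lt hy)
        rw [hev.deriv_eq, deriv_const]
      · have hev : χ =ᶠ[𝓝 x] fun _ => χ b := by
          filter_upwards [(isOpen_lt continuous_const continuous_id).mem_nhds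
            (show b < x by linarith)] with y hy
          exact hhi y (le_of_lt hy)
        rw [hev.deriv_eq, deriv_const]
    rw [hzero, abs_zero]
    exact le_trans zero_le_one (le_max_right _ _)

/-- **Lipschitz consequence**: `|χ x - χ y| ≤ C |x - y|` for such a bound. [folklore] -/
theorem abs_sub_le_of_deriv {χ : ℝ → ℝ} (hχ : Differentiable ℝ χ) {C : ℝ}
    (hC : ∀ x, |deriv χ x| ≤ C) (x y : ℝ) : |χ x - χ y| ≤ C * |x - y| := by
  have hlip : LipschitzWith (Real.toNNReal C) χ := by
    refine lipschitzWith_of_nnnorm_deriv_le (fun x => (hχ x)) fun x => ?_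
    rw [← NNReal.coe_le_coe, coe_nnnorm, Real.norm_eq_abs, Real.coe_toNNReal']
    exact (hC x).trans (le_max_left _ _)
  have := hlip.dist_le_mul x y
  rw [Real.dist_eq, Real.dist_eq, Real.coe_toNNReal'] at this
  have hC0 : 0 ≤ C := (abs_nonneg _).trans (hC 0)
  rwa [max_eq_left hC0] at this

/-! ### The standard cut-offs -/

/-- The cut-off `χ_{a,b} = smoothTransition ((x - a)/(b - a))`: `0` for `x ≤ a`, `1` for `x ≥ b`
(`a < b`). [folklore] -/
def cut (a b x : ℝ) : ℝ := smoothTransition ((x - a) / (b - a))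

/-- The cut-off is smooth. [folklore] -/
theorem contDiff_cut (a b : ℝ) : ContDiff ℝ ∞ (cut a b) :=
  smoothTransition.contDiff.comp ((contDiff_id.sub contDiff_const).div_const _)

/-- `χ = 0` below `a`. [folklore] -/
theorem cut_of_le {a b x : ℝ} (hab : a < b) (hx : x ≤ a) : cut a b x = 0 :=
  smoothTransition.zero_of_nonpos (div_nonpos_of_nonpos_of_nonneg (by linarith) (by linarith))

/-- `χ = 1` above `b`. [folklore] -/
theorem cut_of_ge {a b x : ℝ} (hab : a < b) (hx : b ≤ x) : cut a b x = 1 :=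
  smoothTransition.one_of_one_le ((one_le_div (by linarith)).2 (by linarith))

/-- `0 ≤ χ`. [folklore] -/
theorem cut_nonneg (a b x : ℝ) : 0 ≤ cut a b x := smoothTransition.nonneg _

/-- `χ ≤ 1`. [folklore] -/
theorem cut_le_one (a b x : ℝ) : cut a b x ≤ 1 := smoothTransition.le_one _

/-- The cut-off is monotone. [folklore] -/
theorem cut_mono {a b : ℝ} (hab : a < b) : Monotone (cut a b) := fun _ _ h =>
  smoothTransition.monotone (div_le_div_of_nonneg_right (by linarith) (by linarith))

/-- The cut-off has nonnegative derivative. [folklore] -/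
theorem deriv_cut_nonneg {a b : ℝ} (hab : a < b) (x : ℝ) : 0 ≤ deriv (cut a b) x :=
  (cut_mono hab).deriv_nonneg

/-- The cut-off has bounded derivative. [folklore] -/
theorem exists_bound_deriv_cut {a b : ℝ} (hab : a < b) :
    ∃ C : ℝ, 0 < C ∧ ∀ x, |deriv (cut a b) x| ≤ C :=
  exists_bound_deriv ((contDiff_cut a b).of_le (by simp))
    (fun x hx => by rw [cut_of_le hab hx, cut_of_le hab le_rfl])
    (fun x hx => by rw [cut_of_ge hab hx, cut_of_ge hab le_rfl])

end IwaseTori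
end Literature.Topology.FourManifolds
end
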